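import Summits.MatrixMultiplication.OmegaCensus.STPP222CubeFrom46
import Summits.MatrixMultiplication.OmegaCensus.STPP222SqFrom24
import Summits.MatrixMultiplication.OmegaCensus.STPP222OneFrom8
import Summits.MatrixMultiplication.OmegaCensus.STPP222PowFromCard
import Summits.MatrixMultiplication.OmegaCensus.STPPTricoloredProduct

/-!
# ω-census, `N₅` assembly kit: supported blocks of `Π ℤ/qᵢ`, their STPP / tricolored-sum-free supplies, and the product step

HONEST FRAMING (pub-omega census; verbatim): lottery ticket; floor = certified bounds/negative ranges.
Census STRUCTURE bookkeeping (question Q7 of the pub-omega cell: the uniform threshold `N₅` = least order from which EVERY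
finite abelian group admits five simultaneous-TPP triples of 2-subsets, CKSU 2005 Def. 5.1, tree form `IsSTPP`), not progress on
`ω`: a `(2,2,2)⁵` family certifies no matrix-multiplication bound of interest.

This file is the TOOL layer of the kernel assembly `STPP222Pow5From94.lean` (`N₅ ≤ 94`).  Inside a product `P = Π j, ℤ/q j`
(coordinates `j : ι`, `q j ≥ 1`) a *block* is a set `S` of coordinates; an `S`-supported embedded group is an abelian group `H`
with an injective additive hom `H →+ P` vanishing outside `S`.  We record:

* `STPPOn q S a` / `TSFOn q S t` — some `S`-supported embedded group carries `(2,2,2)^a` / a tricolored-sum-free set of size `t`;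
* SUPPLIES: `(2,2,2)^a` on `S` from the uniform laws `N₁ = 10`, `(2,2,2)²` from `26`, `N₃ = 46` (orders of blocks) and from a
  dominated `(ℤ/2)³`; TSF sets on `S` from one coordinate (`ℤ/q ⊇` 3-AP-free sets: sizes `2, 3, 4, 5` from `q ≥ 3, 7, 9, 17`, and
  `ℤ/13 → 5`), from a coprime pair of coordinates (an element of order `q q'`), from a dominated table type, from the TSF GRAPH on
  two disjoint sub-blocks of orders `≥ t`, and from PRODUCTS of TSF sets on disjoint sub-blocks;
* the PRODUCT STEP `hasPow_of_parts`: `(2,2,2)^a` on `S₁`, a TSF set of size `t` on a disjoint `S₂`, `5 ≤ a·t` ⇒ `(2,2,2)⁵ ⊆ P`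
  (NR142 `exists_isSTPP_222pow_mul_of_tsf` + gluing of disjointly supported embeddings + sub-families);
* `exists_subset_map_eq`: a sub-multiset of the multiset of moduli of a block is the multiset of moduli of a sub-block.

References: H. Cohn, R. Kleinberg, B. Szegedy, C. Umans, FOCS 2005 (arXiv:math/0511460), Def. 5.1; J. Blasiak, T. Church,
H. Cohn, J. Grochow, E. Naslund, W. Sawin, C. Umans, Discrete Analysis 2017:3, Def. 3.1.  Seat pub-omega-stpp-3 (gen 11), 2026-08-25;
plan HOME `pub-omega-stpp-3-g10/N5-ASSEMBLY-PLAN.md`.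
-/

open Literature.Computability.AlgebraicComplexity Literature.Combinatorics.Additive Finset

namespace Summit.MatrixMultiplication.OmegaCensus

namespace N5Kit

variable {ι : Type}

/-! ## 1. The two pattern predicates and their functoriality -/

/-- `H` carries the STPP pattern `(2,2,2)^a`: `a` simultaneous-TPP triples of 2-subsets. [cite: CohnKleinbergSzegedyUmans2005, Def. 5.1] -/
def HasPow (H : Type*) [AddCommGroup H] (a : ℕ) : Prop :=
  ∃ A B C : Fin a → Finset H, IsSTPP A B C ∧ ∀ i, (A i).card = 2 ∧ (B i).card = 2 ∧ (C i).card = 2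

/-- `H` carries a tricolored sum-free set of size `t`. [cite: BlasiakChurchCohnGrochowNaslundSawinUmans2017, Def. 3.1] -/
def HasTSF (H : Type*) [AddCommGroup H] (t : ℕ) : Prop :=
  ∃ s u v : Fin t → H, IsTricoloredSumFree s u v

/-- Sub-families: `(2,2,2)^a ⇒ (2,2,2)^{a'}` for `a' ≤ a`. -/
theorem hasPow_mono {H : Type*} [AddCommGroup H] {a a' : ℕ} (h : a' ≤ a) (hP : HasPow H a) : HasPow H a' := by
  obtain ⟨A, B, C, hS, hc⟩ := hP
  exact ⟨_, _, _, isSTPP_subfamily hS (Fin.castLE h) (Fin.castLE_injective h), fun i => hc _⟩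

/-- Transport of `(2,2,2)^a` along an injective additive hom. -/
theorem hasPow_map {H K : Type*} [AddCommGroup H] [AddCommGroup K] {a : ℕ} (φ : H →+ K)
    (hφ : Function.Injective φ) (hP : HasPow H a) : HasPow K a :=
  exists_isSTPP_222pow_of_injective φ hφ hP

/-- Sub-sets of a tricolored sum-free set are tricolored sum-free. -/
theorem hasTSF_mono {H : Type*} [AddCommGroup H] {t t' : ℕ} (h : t' ≤ t) (hT : HasTSF H t) : HasTSF H t' := by
  obtain ⟨s, u, v, hs⟩ := hT
  exact ⟨_, _, _, hs.comp (Fin.castLE_injective h)⟩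

/-- Transport of a tricolored sum-free set along an injective additive hom. -/
theorem hasTSF_map {H K : Type*} [AddCommGroup H] [AddCommGroup K] {t : ℕ} (φ : H →+ K)
    (hφ : Function.Injective φ) (hT : HasTSF H t) : HasTSF K t := by
  obtain ⟨s, u, v, hs⟩ := hT
  exact ⟨_, _, _, hs.map φ hφ⟩

/-- The one-point tricolored sum-free set. -/
theorem hasTSF_one {H : Type*} [AddCommGroup H] : HasTSF H 1 :=
  ⟨![0], ![0], ![0], fun i j l => by fin_cases i; fin_cases j; fin_cases l; simp⟩

/-- Products of tricolored sum-free sets (coordinatewise, `Fin (t₂ t₃) ≃ Fin t₂ × Fin t₃`).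
[cite: BlasiakChurchCohnGrochowNaslundSawinUmans2017, Def. 3.1] -/
theorem hasTSF_prod {H K : Type*} [AddCommGroup H] [AddCommGroup K] {t₂ t₃ : ℕ} (h₂ : HasTSF H t₂)
    (h₃ : HasTSF K t₃) : HasTSF (H × K) (t₂ * t₃) := by
  obtain ⟨s, u, v, hs⟩ := h₂
  obtain ⟨s', u', v', hs'⟩ := h₃
  have hp : IsTricoloredSumFree (fun p : Fin t₂ × Fin t₃ => ((s p.1, s' p.2) : H × K))
      (fun p => (u p.1, u' p.2)) (fun p => (v p.1, v' p.2)) := by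
    intro i j l
    rw [Prod.mk_add_mk, Prod.mk_add_mk, Prod.mk_eq_zero, hs i.1 j.1 l.1, hs' i.2 j.2 l.2, Prod.ext_iff, Prod.ext_iff]
    tauto
  exact ⟨_, _, _, hp.comp (e := finProdFinEquiv.symm) finProdFinEquiv.symm.injective⟩

/-! ## 2. Tricolored sum-free sets in cyclic groups -/

/-- The TSF size this kit extracts from a cyclic group `ℤ/e`: `5` for `e ≥ 13`, `4` for `e ≥ 9`, `3` for `e ≥ 7`, `2` for `e ≥ 3`. -/
def tsfCyc (e : ℕ) : ℕ := if 13 ≤ e then 5 else if 9 ≤ e then 4 else if 7 ≤ e then 3 else if 3 ≤ e then 2 else 1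

/-- **Midpoint-free sets of naturals give tricolored sum-free sets in `ℤ/n`.**  If `f : Fin k → ℕ` satisfies
`fᵢ + fⱼ = 2 f_l ⇒ i = l = j` (no non-trivial 3-term progressions, injectivity included) and `2 fᵢ < n`, then
`(fᵢ, fⱼ, −2 f_l)` is tricolored sum-free in `ℤ/n`: `fᵢ + fⱼ − 2 f_l ≡ 0 (mod n)` forces equality in `ℕ` (the integer has absolute
value `< n`).  (The argument of `STPPThreeAPFree.isTricoloredSumFree_of_threeAPFree`, restated for a decidable hypothesis.)
[cite: BlasiakChurchCohnGrochowNaslundSawinUmans2017, Def. 3.1] -/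
theorem hasTSF_zmod_of_midpointFree {k n : ℕ} (f : Fin k → ℕ)
    (hf : ∀ i j l : Fin k, f i + f j = f l + f l → i = l ∧ j = l) (hn : ∀ i, 2 * f i < n) : HasTSF (ZMod n) k := by
  refine ⟨fun i => (f i : ZMod n), fun i => (f i : ZMod n), fun i => -(2 * (f i : ZMod n)), fun i j l => ?_⟩
  constructor
  · intro h0
    have hz : ((f i + f j - 2 * f l : ℤ) : ZMod n) = 0 := by
      push_cast
      have : (f i : ZMod n) + f j - 2 * f l = (f i : ZMod n) + f j + -(2 * f l) := by ring
      rw [this]; exact h0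
    have hdvd : (n : ℤ) ∣ (f i + f j - 2 * f l : ℤ) := (ZMod.intCast_zmod_eq_zero_iff_dvd _ _).1 hz
    have hi := hn i; have hj := hn j; have hl := hn l
    have habs : |(f i + f j - 2 * f l : ℤ)| < n := by
      rw [abs_lt]; constructor <;> omega
    have h0z : (f i + f j - 2 * f l : ℤ) = 0 := Int.eq_zero_of_abs_lt_dvd hdvd habs
    obtain ⟨hil, hjl⟩ := hf i j l (by omega)
    exact ⟨hil.trans hjl.symm, hjl⟩
  · rintro ⟨rfl, rfl⟩; ring

/-- **`ℤ/e` carries a tricolored sum-free set of size `tsfCyc e`** (midpoint-free sets `{0,1,3,7,8}`, `{0,1,3,4}`, `{0,1,3}`,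
`{0,1}` for `e ≥ 17, 9, 7, 3`; the kernel instance `ℤ/13 → 5` of `STPPTricoloredProduct`; `ℤ/14, ℤ/15, ℤ/16 → 5` by the explicit
sets of `STPPTricoloredToolkit`, re-decided here). [cite: BlasiakChurchCohnGrochowNaslundSawinUmans2017, Def. 3.1] -/
theorem hasTSF_zmod_tsfCyc (e : ℕ) : HasTSF (ZMod e) (tsfCyc e) := by
  unfold tsfCyc
  by_cases h13 : 13 ≤ e
  · rw [if_pos h13]
    by_cases h17 : 17 ≤ e
    · exact hasTSF_zmod_of_midpointFree ![0, 1, 3, 7, 8] (by decide) (fun i => by fin_cases i <;> simp <;> omega)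
    interval_cases e
    · exact exists_isTSF_five_zmod13
    · exact ⟨![0, 1, 3, 9, 12], ![0, 1, 3, 10, 9], ![0, 12, 8, 9, 7], by unfold IsTricoloredSumFree; decide⟩
    · exact ⟨![0, 1, 3, 4, 9], ![0, 1, 3, 7, 4], ![0, 13, 9, 4, 2], by unfold IsTricoloredSumFree; decide⟩
    · exact ⟨![0, 1, 3, 4, 7], ![0, 1, 3, 8, 7], ![0, 14, 10, 4, 2], by unfold IsTricoloredSumFree; decide⟩
  rw [if_neg h13]
  by_cases h9 : 9 ≤ e
  · rw [if_pos h9]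
    exact hasTSF_zmod_of_midpointFree ![0, 1, 3, 4] (by decide) (fun i => by fin_cases i <;> simp <;> omega)
  rw [if_neg h9]
  by_cases h7 : 7 ≤ e
  · rw [if_pos h7]
    exact hasTSF_zmod_of_midpointFree ![0, 1, 3] (by decide) (fun i => by fin_cases i <;> simp <;> omega)
  rw [if_neg h7]
  by_cases h3 : 3 ≤ e
  · rw [if_pos h3]
    exact hasTSF_zmod_of_midpointFree ![0, 1] (by decide) (fun i => by fin_cases i <;> simp <;> omega)
  rw [if_neg h3]
  exact hasTSF_one

/-! ## 3. Supported embedded blocks of `Π j, ℤ/q j` -/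

/-- Some `S`-supported embedded group (an abelian group with an injective additive hom into `Π j, ℤ/q j` vanishing outside the
coordinates in `S`) carries `(2,2,2)^a`. [cite: CohnKleinbergSzegedyUmans2005, Def. 5.1] -/
def STPPOn (q : ι → ℕ) (S : Finset ι) (a : ℕ) : Prop :=
  ∃ (H : Type) (_ : AddCommGroup H) (φ : H →+ (Π j, ZMod (q j))),
    Function.Injective φ ∧ (∀ x, ∀ j ∉ S, φ x j = 0) ∧ HasPow H a

/-- Some `S`-supported embedded group carries a tricolored sum-free set of size `t`.
[cite: BlasiakChurchCohnGrochowNaslundSawinUmans2017, Def. 3.1] -/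
def TSFOn (q : ι → ℕ) (S : Finset ι) (t : ℕ) : Prop :=
  ∃ (H : Type) (_ : AddCommGroup H) (φ : H →+ (Π j, ZMod (q j))),
    Function.Injective φ ∧ (∀ x, ∀ j ∉ S, φ x j = 0) ∧ HasTSF H t

variable {q : ι → ℕ}

/-- Monotonicity of `TSFOn` in the block and in the size. -/
theorem TSFOn.mono {S S' : Finset ι} {t t' : ℕ} (hS : S ⊆ S') (ht : t' ≤ t) (h : TSFOn q S t) : TSFOn q S' t' := by
  obtain ⟨H, _, φ, hφ, hsupp, hT⟩ := h
  exact ⟨H, inferInstance, φ, hφ, fun x j hj => hsupp x j (fun h => hj (hS h)), hasTSF_mono ht hT⟩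

/-- Monotonicity of `STPPOn` in the block. -/
theorem STPPOn.mono {S S' : Finset ι} {a : ℕ} (hS : S ⊆ S') (h : STPPOn q S a) : STPPOn q S' a := by
  obtain ⟨H, _, φ, hφ, hsupp, hP⟩ := h
  exact ⟨H, inferInstance, φ, hφ, fun x j hj => hsupp x j (fun h => hj (hS h)), hP⟩

/-- **The block group `Π_{i ∈ S} ℤ/q i` embeds into `Π j, ℤ/q j` supported on `S`** (extension by zero). [folklore] -/
theorem exists_blockEmb [DecidableEq ι] (q : ι → ℕ) (S : Finset ι) :
    ∃ φ : (Π i : {i // i ∈ S}, ZMod (q i)) →+ (Π j, ZMod (q j)),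
      Function.Injective φ ∧ ∀ x, ∀ j ∉ S, φ x j = 0 := by
  refine ⟨{ toFun := fun x j => if h : j ∈ S then x ⟨j, h⟩ else 0,
            map_zero' := ?_, map_add' := ?_ }, ?_, ?_⟩
  · funext j
    split <;> rfl
  · intro x y
    funext j
    simp only [Pi.add_apply]
    split <;> simp
  · intro x y hxy
    funext ⟨j, hj⟩
    have := congr_fun hxy j
    simpa only [AddMonoidHom.coe_mk, ZeroHom.coe_mk, dif_pos hj] using this
  · intro x j hj
    simp only [AddMonoidHom.coe_mk, ZeroHom.coe_mk, dif_neg hj]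

/-- The order of the block group `Π_{i ∈ S} ℤ/q i` is `∏_{i ∈ S} q i` (`natCard_pi_zmod_mem`), which is the product of the
multiset of moduli `S.val.map q`. -/
theorem prod_map_val (q : ι → ℕ) (S : Finset ι) : (S.val.map q).prod = ∏ i ∈ S, q i := rfl

/-! ## 4. STPP supplies on a block -/

/-- `(2,2,2)^a` on `S` from a uniform law applied to the block group `Π_{i ∈ S} ℤ/q i` (whose order is the product of the
moduli): any law `T ≤ |K| ⇒ (2,2,2)^a ⊆ K` valid for all finite abelian `K`. [cite: CohnKleinbergSzegedyUmans2005, Def. 5.1] -/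
theorem stppOn_of_law [Fintype ι] [DecidableEq ι] (hq : ∀ i, 0 < q i) (S : Finset ι) {a T : ℕ}
    (law : ∀ {K : Type} [AddCommGroup K] [Finite K], T ≤ Nat.card K → HasPow K a)
    (hS : T ≤ (S.val.map q).prod) : STPPOn q S a := by
  haveI : ∀ i, NeZero (q i) := fun i => ⟨(hq i).ne'⟩
  obtain ⟨φ, hφ, hsupp⟩ := exists_blockEmb q S
  have hcard : Nat.card (Π i : {i // i ∈ S}, ZMod (q i)) = (S.val.map q).prod := by
    rw [natCard_pi_zmod_mem, prod_map_val]
  exact ⟨_, inferInstance, φ, hφ, hsupp, law (by rw [hcard]; exact hS)⟩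

/-- `(2,2,2)³` on a block of order `≥ 46` (`N₃ = 46`, `exists_isSTPP_222cube_of_card`). [cite: CohnKleinbergSzegedyUmans2005, Def. 5.1] -/
theorem stppOn_three [Fintype ι] [DecidableEq ι] (hq : ∀ i, 0 < q i) (S : Finset ι) (hS : 46 ≤ (S.val.map q).prod) :
    STPPOn q S 3 :=
  stppOn_of_law hq S (fun h => exists_isSTPP_222cube_of_card h) hS

/-- `(2,2,2)²` on a block of order `≥ 26` (`exists_isSTPP_222sq_of_card`). [cite: CohnKleinbergSzegedyUmans2005, Def. 5.1] -/
theorem stppOn_two [Fintype ι] [DecidableEq ι] (hq : ∀ i, 0 < q i) (S : Finset ι) (hS : 26 ≤ (S.val.map q).prod) :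
    STPPOn q S 2 :=
  stppOn_of_law hq S (fun h => exists_isSTPP_222sq_of_card h) hS

/-- `(2,2,2)¹` on a block of order `≥ 10` (`N₁ = 10`, `exists_isSTPP_222one_of_card`). [cite: CohnKleinbergSzegedyUmans2005, Def. 5.1] -/
theorem stppOn_one [Fintype ι] [DecidableEq ι] (hq : ∀ i, 0 < q i) (S : Finset ι) (hS : 10 ≤ (S.val.map q).prod) :
    STPPOn q S 1 :=
  stppOn_of_law hq S (fun h => exists_isSTPP_222one_of_card h) hS

/-- `(2,2,2)¹` on `S` from a dominated `(ℤ/2)³` (`exists_emb_of_dom` + the kernel seed `exists_isSTPP_222pow1_seed_2_2_2`).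
[cite: CohnKleinbergSzegedyUmans2005, Def. 5.1] -/
theorem stppOn_of_dom222 [DecidableEq ι] (hq : ∀ i, 0 < q i) (S : Finset ι) (h : dom [2, 2, 2] (S.val.map q) = true) :
    STPPOn q S 1 := by
  obtain ⟨φ, hφ, hsupp⟩ := exists_emb_of_dom q (fun i => (hq i).ne') [2, 2, 2] S h
  exact ⟨SeedType [2, 2, 2], inferInstance, φ, hφ, hsupp, exists_isSTPP_222pow1_seed_2_2_2⟩

/-- `(2,2,2)^a` on `S` (hence in `Π j, ℤ/q j`) from a dominated seed type carrying it. [cite: CohnKleinbergSzegedyUmans2005, Def. 5.1] -/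
theorem hasPow_of_dom [DecidableEq ι] (hq : ∀ i, 0 < q i) (S : Finset ι) {s : List ℕ} {a : ℕ} (h : dom s (S.val.map q) = true)
    (hs : HasPow (SeedType s) a) : HasPow (Π j, ZMod (q j)) a := by
  obtain ⟨φ, hφ, -⟩ := exists_emb_of_dom q (fun i => (hq i).ne') s S h
  exact hasPow_map φ hφ hs

/-! ## 5. TSF supplies on a block -/

/-- From ONE coordinate `i ∈ S`: `ℤ/q i ⊇` a TSF set of size `tsfCyc (q i)`. -/
theorem tsfOn_single [DecidableEq ι] (S : Finset ι) {i : ι} (hi : i ∈ S) {t : ℕ} (ht : t ≤ tsfCyc (q i)) : TSFOn q S t := by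
  refine ⟨ZMod (q i), inferInstance, AddMonoidHom.single (fun j => ZMod (q j)) i,
    Pi.single_injective (M := fun j => ZMod (q j)) i, ?_,
    hasTSF_mono ht (hasTSF_zmod_tsfCyc (q i))⟩
  intro x j hj
  have hji : j ≠ i := fun h => hj (h ▸ hi)
  simp [Pi.single_eq_of_ne hji]

/-- The trivial supply: every block carries a TSF set of size `≤ 1` (on the zero group). -/
theorem tsfOn_of_le_one (S : Finset ι) {t : ℕ} (ht : t ≤ 1) : TSFOn q S t :=
  ⟨PUnit, inferInstance, 0, fun a b _ => Subsingleton.elim a b, fun _ _ _ => rfl, hasTSF_mono ht hasTSF_one⟩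

/-- An element `c` of `Π j, ℤ/q j` supported on `S` spans a copy of `ℤ/(ord c)` supported on `S`. -/
theorem exists_emb_of_elem (S : Finset ι) (c : Π j, ZMod (q j)) (hc : ∀ j ∉ S, c j = 0) {n : ℕ}
    (hn : addOrderOf c = n) :
    ∃ φ : ZMod n →+ (Π j, ZMod (q j)), Function.Injective φ ∧ ∀ x, ∀ j ∉ S, φ x j = 0 := by
  subst hn
  refine ⟨ZMod.lift (addOrderOf c) ⟨zmultiplesHom _ c, zmultiples_lift_spec c⟩, zmod_lift_zmultiples_injective c, ?_⟩
  intro x j hj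
  obtain ⟨k, rfl⟩ := ZMod.intCast_surjective x
  simp [ZMod.lift_coe, hc j hj]

/-- From a COPRIME PAIR of coordinates `i, i'` in `S`: an element of order `q i · q i'`, hence `ℤ/(q i q i') ⊇` a TSF set of size
`tsfCyc (q i q i')`. -/
theorem tsfOn_pair [DecidableEq ι] (S : Finset ι) {i i' : ι} (hi : i ∈ S) (hi' : i' ∈ S)
    (hcop : Nat.Coprime (q i) (q i')) {t : ℕ} (ht : t ≤ tsfCyc (q i * q i')) : TSFOn q S t := by
  set c : Π j, ZMod (q j) := Pi.single i 1 + Pi.single i' 1 with hcdef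
  have ho1 : addOrderOf (Pi.single i (1 : ZMod (q i)) : Π j, ZMod (q j)) = q i := by
    rw [← AddMonoidHom.single_apply, addOrderOf_injective _ (Pi.single_injective (M := fun j => ZMod (q j)) i),
      ZMod.addOrderOf_one]
  have ho2 : addOrderOf (Pi.single i' (1 : ZMod (q i')) : Π j, ZMod (q j)) = q i' := by
    rw [← AddMonoidHom.single_apply, addOrderOf_injective _ (Pi.single_injective (M := fun j => ZMod (q j)) i'),
      ZMod.addOrderOf_one]
  have hord : addOrderOf c = q i * q i' := by
    rw [hcdef, AddCommute.addOrderOf_add_eq_mul_addOrderOf_of_coprime (AddCommute.all _ _) (by rwa [ho1, ho2]), ho1, ho2]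
  have hsupp : ∀ j ∉ S, c j = 0 := by
    intro j hj
    have h1 : j ≠ i := fun h => hj (h ▸ hi)
    have h2 : j ≠ i' := fun h => hj (h ▸ hi')
    simp [hcdef, Pi.single_eq_of_ne h1, Pi.single_eq_of_ne h2]
  obtain ⟨φ, hφ, hφs⟩ := exists_emb_of_elem S c hsupp hord
  exact ⟨_, inferInstance, φ, hφ, hφs, hasTSF_mono ht (hasTSF_zmod_tsfCyc _)⟩

/-- From a DOMINATED TABLE TYPE: a list of moduli `s` dominated by the block's moduli, with a TSF set of size `t` in `SeedType s`. -/
theorem tsfOn_of_dom [DecidableEq ι] (hq : ∀ i, 0 < q i) (S : Finset ι) {s : List ℕ} {t : ℕ} (h : dom s (S.val.map q) = true)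
    (hs : HasTSF (SeedType s) t) : TSFOn q S t := by
  obtain ⟨φ, hφ, hsupp⟩ := exists_emb_of_dom q (fun i => (hq i).ne') s S h
  exact ⟨SeedType s, inferInstance, φ, hφ, hsupp, hs⟩

/-- **TSF GRAPH on two disjoint sub-blocks**: if `∏_{T} q ≥ t` and `∏_{U} q ≥ t` then the block `T ∪ U` carries a TSF set of
size `t` (injections `p : Fin t ↪ Π_T ℤ/q`, `r : Fin t ↪ Π_U ℤ/q`; triples `(pᵢ, 0), (0, rⱼ), (−p_l, −r_l)`).
[cite: BlasiakChurchCohnGrochowNaslundSawinUmans2017, Def. 3.1] -/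
theorem tsfOn_graph [Fintype ι] [DecidableEq ι] (hq : ∀ i, 0 < q i) {T U : Finset ι} (hTU : Disjoint T U) {t : ℕ}
    (hT : t ≤ (T.val.map q).prod) (hU : t ≤ (U.val.map q).prod) : TSFOn q (T ∪ U) t := by
  haveI : ∀ i, NeZero (q i) := fun i => ⟨(hq i).ne'⟩
  obtain ⟨φ, hφ, hφs⟩ := exists_blockEmb q T
  obtain ⟨ψ, hψ, hψs⟩ := exists_blockEmb q U
  -- injections `Fin t ↪` the two block groups
  have hcT : t ≤ Fintype.card (Π i : {i // i ∈ T}, ZMod (q i)) := by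
    rw [← Nat.card_eq_fintype_card, natCard_pi_zmod_mem, ← prod_map_val]; exact hT
  have hcU : t ≤ Fintype.card (Π i : {i // i ∈ U}, ZMod (q i)) := by
    rw [← Nat.card_eq_fintype_card, natCard_pi_zmod_mem, ← prod_map_val]; exact hU
  obtain ⟨p⟩ : Nonempty (Fin t ↪ (Π i : {i // i ∈ T}, ZMod (q i))) :=
    Function.Embedding.nonempty_iff_card_le.2 (by rwa [Fintype.card_fin])
  obtain ⟨r⟩ : Nonempty (Fin t ↪ (Π i : {i // i ∈ U}, ZMod (q i))) :=
    Function.Embedding.nonempty_iff_card_le.2 (by rwa [Fintype.card_fin])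
  have hG : IsTricoloredSumFree (fun i => ((p i, 0) : (Π i : {i // i ∈ T}, ZMod (q i)) × (Π i : {i // i ∈ U}, ZMod (q i))))
      (fun i => (0, r i)) (fun i => (-p i, -r i)) := by
    intro i j l
    constructor
    · intro h
      simp only [Prod.mk_add_mk, add_zero, zero_add, Prod.mk_eq_zero, ← sub_eq_add_neg, sub_eq_zero] at h
      exact ⟨(p.injective h.1).trans (r.injective h.2).symm, r.injective h.2⟩
    · rintro ⟨rfl, rfl⟩
      simp
  refine ⟨_, inferInstance, φ.coprod ψ,
    coprod_injective_of_support φ ψ (fun j => j ∈ T) hφ hψ (fun x j hj => hφs x j hj)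
      (fun y j hj => hψs y j (Finset.disjoint_left.1 hTU hj)), ?_, ⟨_, _, _, hG⟩⟩
  intro z j hj
  rw [Finset.mem_union, not_or] at hj
  rw [AddMonoidHom.coprod_apply, Pi.add_apply, hφs z.1 j hj.1, hψs z.2 j hj.2, add_zero]

/-- **PRODUCT of TSF sets on two disjoint sub-blocks.** [cite: BlasiakChurchCohnGrochowNaslundSawinUmans2017, Def. 3.1] -/
theorem tsfOn_mul [DecidableEq ι] {T U : Finset ι} (hTU : Disjoint T U) {t₂ t₃ : ℕ} (h₂ : TSFOn q T t₂) (h₃ : TSFOn q U t₃) :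
    TSFOn q (T ∪ U) (t₂ * t₃) := by
  obtain ⟨H, _, φ, hφ, hφs, hH⟩ := h₂
  obtain ⟨K, _, ψ, hψ, hψs, hK⟩ := h₃
  refine ⟨H × K, inferInstance, φ.coprod ψ,
    coprod_injective_of_support φ ψ (fun j => j ∈ T) hφ hψ (fun x j hj => hφs x j hj)
      (fun y j hj => hψs y j (Finset.disjoint_left.1 hTU hj)), ?_, hasTSF_prod hH hK⟩
  intro z j hj
  rw [Finset.mem_union, not_or] at hj
  rw [AddMonoidHom.coprod_apply, Pi.add_apply, hφs z.1 j hj.1, hψs z.2 j hj.2, add_zero]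

/-! ## 6. The product step and sub-blocks -/

/-- **PRODUCT STEP.** `(2,2,2)^a` on a block `S₁` and a tricolored sum-free set of size `t` on a disjoint block `S₂` with
`5 ≤ a·t` give `(2,2,2)⁵ ⊆ Π j, ℤ/q j` (NR142 `exists_isSTPP_222pow_mul_of_tsf` in `H₁ × H₂`, glued into `Π j, ℤ/q j` along the
two disjointly supported embeddings, then a sub-family). [cite: CohnKleinbergSzegedyUmans2005, Def. 5.1] -/
theorem hasPow_of_parts {S₁ S₂ : Finset ι} (hS : Disjoint S₁ S₂) {a t : ℕ} (h₁ : STPPOn q S₁ a) (h₂ : TSFOn q S₂ t)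
    (hat : 5 ≤ a * t) : HasPow (Π j, ZMod (q j)) 5 := by
  obtain ⟨H, _, φ, hφ, hφs, hH⟩ := h₁
  obtain ⟨K, _, ψ, hψ, hψs, s, u, v, hT⟩ := h₂
  have hHK : HasPow (H × K) (a * t) := exists_isSTPP_222pow_mul_of_tsf hH hT
  have hinj : Function.Injective (φ.coprod ψ) :=
    coprod_injective_of_support φ ψ (fun j => j ∈ S₁) hφ hψ (fun x j hj => hφs x j hj)
      (fun y j hj => hψs y j (Finset.disjoint_left.1 hS hj))
  exact hasPow_mono hat (hasPow_map _ hinj hHK)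

/-- **A sub-multiset of the moduli of a block is the multiset of moduli of a sub-block.** -/
theorem exists_subset_map_eq [DecidableEq ι] (q : ι → ℕ) :
    ∀ (S : Finset ι) (B : Multiset ℕ), B ≤ S.val.map q → ∃ T ⊆ S, T.val.map q = B := by
  intro S
  induction S using Finset.induction_on with
  | empty =>
      intro B hB
      refine ⟨∅, Subset.refl _, ?_⟩
      have : B = 0 := by simpa using hB
      rw [this]; rfl
  | insert a S ha ih =>
      intro B hB
      rw [Finset.insert_val_of_notMem ha, Multiset.map_cons] at hB
      obtain ⟨T, hTS, hT⟩ := ih (B.erase (q a)) (Multiset.erase_le_iff_le_cons.2 hB)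
      by_cases hmem : q a ∈ B
      · refine ⟨insert a T, Finset.insert_subset_insert a hTS, ?_⟩
        rw [Finset.insert_val_of_notMem (fun h => ha (hTS h)), Multiset.map_cons, hT, Multiset.cons_erase hmem]
      · exact ⟨T, hTS.trans (Finset.subset_insert a S), by rw [hT, Multiset.erase_of_notMem hmem]⟩

/-- The moduli of `S \ T` for `T ⊆ S`: the difference of the multisets of moduli. -/
theorem map_val_sdiff [DecidableEq ι] (q : ι → ℕ) {S T : Finset ι} (hTS : T ⊆ S) :
    (S \ T).val.map q = S.val.map q - T.val.map q := by
  have h : S.val = (S \ T).val + T.val := by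
    conv_lhs => rw [← Finset.sdiff_union_of_subset hTS, ← Finset.disjUnion_eq_union _ _ Finset.sdiff_disjoint]
    rfl
  rw [h, Multiset.map_add, add_tsub_cancel_right]

end N5Kit

end Summit.MatrixMultiplication.OmegaCensus
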